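import Summits.CriticalPhenomena.PercolationContinuityZ3.Theorems.PercFiniteBoxLROCerf2015BoxLRO16Connect
import Summits.CriticalPhenomena.PercolationContinuityZ3.Theorems.PercFiniteBoxLROCerf2015BoxLRO16Covering
import Summits.CriticalPhenomena.PercolationContinuityZ3.Theorems.PercNonProliferationNonProliferationStubAnchor
import Literature.Probability.Percolation.ConstrainedClusters
import HarnessLib

/-!
# Crux `PercFiniteBoxLRO.LinearScaleLROOfTheta` (stmt-CriticalPhenomena-0855), line `birth` — stub `stub_fkgChaining`

Helper file for the lead's skeleton of line `birth` (`work/LinearScaleLROOfTheta.lean`,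
prover-line-stmt-CriticalPhenomena-0855-0). Proves exactly the registered stub signature
`stub_fkgChaining`; lands with `--supports stmt-CriticalPhenomena-0855`.

**The statement** (Cerf 2015, §10, closing paragraph "By symmetry and the FKG inequality … Using the
FKG inequality, we conclude", run at LINEAR scale for BOND percolation on `ℤ³`): if for some `ρ₀ > 0`,
`K ≥ 1` and every `n ≥ 1` some inner-boundary site `x_n ∈ ∂ⁱⁿΛ_n` has
`P_p(0 ↔ x_n in Λ_{Kn}) ≥ ρ₀`, then `P_p(x ↔ y in Λ_{K'n}) ≥ ρ` for all `n ≥ 1`, `x, y ∈ Λ_n`, with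
`ρ = (p ρ₀²)³` and `K' = K + 5`.

**The proof** adapts the tree's `Λ(n^16)` version (`…Cerf2015BoxLRO16Scale.exists_axis_all`,
`…Cerf2015BoxLRO16.exists_rho_large`, `cerf2015BoxLRO16_proof`) to linear boxes:
* the statement's event `openConnIn ↑Λ x y` is a.s. the lattice-path event `AKN.bconn Λ x y` when
  `x ∈ Λ` (`openConnIn_ae_eq_openConnVia`);
* `p > 0` is forced by the hypothesis at `n = 1` (`P_0 = dirac ∅`, and `x_1 ≠ 0`; the tree's
  `NonProliferation.StubAnchor.eq_of_empty_mem_openConnIn`);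
* even axis points `2m σ e_j` inside `Λ_{(K+2)m}` with floor `ρ₀²` (`sq_le_real_bconn_axis`: signed
  permutation, reflection, Harris–FKG), odd ones `(2m+1) σ e_j` by one more open edge
  (`real_bconn_adj_le`, factor `p`), `k ≤ 1` by a straight segment (`pow_le_real_bconn_single`);
  all `k ≤ 2n` inside `Λ_{(K+2)n}` with floor `ρ₁ = p ρ₀²` (box monotonicity);
* three translated legs glued by Harris–FKG (`real_bconn_translate`, `real_bconn_mul_le`) give
  every `w ∈ Λ_{2n}` from `0` inside `Λ_{(K+4)n}` with floor `ρ₁³`, and a last translation by `x`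
  gives every pair `x, y ∈ Λ_n` inside `Λ_{(K+5)n}` (`ball_subset_box_add`).

No definition is introduced.

## References

* R. Cerf, *A lower bound on the two-arms exponent for critical percolation on the lattice*, Ann.
  Probab. 43 (2015) 2458–2480, §10 (arXiv:1306.3105 p. 15) [Cerf2015].
-/

noncomputable section

namespace Summit.CriticalPhenomena.PercolationContinuityZ3.Theorems

namespace LinearScaleLROChaining

open Literature.Probability.Percolation Literature.Probability.Percolation.AKN
  Literature.Probability.Percolation.GM Literature.Probability.LatticeModels MeasureTheory Finset
open Cerf2015BoxLRO16
open scoped Classical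

/-- An inner-boundary site of `Λ_1` is not the origin. [folklore] -/
theorem ne_zero_of_mem_innerBoundary_box_one {x : Site 3}
    (hx : x ∈ innerBoundary (zdGraph 3) (box 3 1)) : x ≠ 0 := by
  obtain ⟨i, hi⟩ := exists_eq_of_mem_innerBoundary_box hx
  rintro rfl
  simp at hi

/-- **`p > 0` is forced by the chaining hypothesis at scale `1`**: at `p = 0` the percolation
measure is `dirac ∅` (`setBernoulli_zero`, cf. `theta_bot`), under which `{0 ↔ x in S}` with
`x ≠ 0` is null. [folklore] -/
theorem coe_pos_of_glued (p : unitInterval) {ρ₀ : ℝ} (hρ₀ : 0 < ρ₀) {S : Set (Site 3)} {x : Site 3}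
    (hx : x ∈ innerBoundary (zdGraph 3) (box 3 1))
    (h : ρ₀ ≤ (bondPercolation (zdGraph 3) p).real (openConnIn S (0 : Site 3) x)) :
    0 < (p : ℝ) := by
  rcases eq_or_lt_of_le p.2.1 with hp | hp
  · exfalso
    have hp' : p = 0 := Subtype.ext hp.symm
    have hnot : (∅ : BondConfig (Site 3)) ∉ openConnIn S (0 : Site 3) x :=
      fun hmem => ne_zero_of_mem_innerBoundary_box_one hx
        (NonProliferation.StubAnchor.eq_of_empty_mem_openConnIn hmem).symm
    rw [hp'] at h
    simp only [bondPercolation, ProbabilityTheory.setBernoulli_zero, measureReal_def,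
      Measure.dirac_apply, Set.indicator_of_notMem hnot, ENNReal.toReal_zero] at h
    exact absurd h (not_le.2 hρ₀)
  · exact hp

/-- The statement's event `{x ↔ y in Λ_m}` (`openConnIn`) has the probability of the lattice-path
event `AKN.bconn Λ_m x y` as soon as `x ∈ Λ_m` (`openConnIn_ae_eq_openConnVia`). [folklore] -/
theorem real_openConnIn_box_eq (p : unitInterval) {m : ℕ} {x : Site 3} (hx : x ∈ box 3 m) (y : Site 3) :
    (bondPercolation (zdGraph 3) p).real (openConnIn (↑(box 3 m) : Set (Site 3)) x y) =
      (bondPercolation (zdGraph 3) p).real (bconn (box 3 m) x y) :=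
  measureReal_congr (openConnIn_ae_eq_openConnVia (zdGraph 3) p (Finset.mem_coe.2 hx) y)

/-- Box monotonicity of `P_p(x ↔ y in Λ_B)`. [folklore] -/
theorem real_bconn_box_mono (p : unitInterval) {B B' : ℕ} (h : B ≤ B') (x y : Site 3) :
    (bondPercolation (zdGraph 3) p).real (bconn (box 3 B) x y) ≤
      (bondPercolation (zdGraph 3) p).real (bconn (box 3 B') x y) :=
  measureReal_mono (openConnVia_mono_graph (withinGraph_mono _ (Finset.coe_subset.2 (box_mono 3 h))) x y)
    (measure_ne_top _ _)

/-- **All axis points at linear scale** (Cerf 2015, §10: "By symmetry and the FKG inequality,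
`P(0 ↔ 2ne₁ in Λ(4n+n^α)) ≥ P(0 ↔ x_n in Λ(n+n^α))²` … `P(0 ↔ k e₁ …) ≥ (p/4) θ(p)⁴`", with
`Λ(n+n^α)` replaced by `Λ(Kn)`): from one glued inner-boundary site per scale with floor `ρ₀` inside
`Λ_{Km}`, every axis point `σ k e_j`, `k ≤ 2n`, is glued to `0` inside `Λ_{(K+2)n}` with floor
`p ρ₀²` (even `k = 2m` by `sq_le_real_bconn_axis` at scale `m`, odd `k = 2m+1 ≥ 3` by one more open
edge, `k ≤ 1` by a straight segment). [cite: Cerf2015, §10] -/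
theorem axis_all_linear (p : unitInterval) {ρ₀ : ℝ} (hρ₀ : 0 < ρ₀) (hρ₀1 : ρ₀ ≤ 1) {K : ℕ} (hK : 1 ≤ K)
    (hyp : ∀ m : ℕ, 1 ≤ m → ∃ x ∈ innerBoundary (zdGraph 3) (box 3 m),
      ρ₀ ≤ (bondPercolation (zdGraph 3) p).real (bconn (box 3 (K * m)) 0 x))
    {n : ℕ} (hn : 1 ≤ n) (j : Fin 3) (s : ℤˣ) {k : ℕ} (hk : k ≤ 2 * n) :
    (p : ℝ) * ρ₀ ^ 2 ≤
      (bondPercolation (zdGraph 3) p).real (bconn (box 3 ((K + 2) * n)) 0 (Pi.single j ((s : ℤ) * k))) := by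
  set μ := bondPercolation (zdGraph 3) p
  have hp1 : (p : ℝ) ≤ 1 := p.2.2
  have hp0 : (0 : ℝ) ≤ p := p.2.1
  have hρp : (p : ℝ) * ρ₀ ^ 2 ≤ p :=
    (mul_le_mul_of_nonneg_left (pow_le_one₀ hρ₀.le hρ₀1) hp0).trans_eq (mul_one _)
  by_cases hk1 : k ≤ 1
  · -- a straight segment of `k ≤ 1` edges
    have hkB : k ≤ (K + 2) * n := le_trans (by omega) (Nat.le_mul_of_pos_left n (by omega))
    calc (p : ℝ) * ρ₀ ^ 2 ≤ (p : ℝ) ^ 1 := by rw [pow_one]; exact hρp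
      _ ≤ (p : ℝ) ^ k := pow_le_pow_of_le_one hp0 hp1 hk1
      _ ≤ _ := pow_le_real_bconn_single p j s hkB
  · push Not at hk1
    obtain ⟨m, hm⟩ := Nat.even_or_odd' k
    have hm1 : 1 ≤ m := by omega
    have hmn : m ≤ n := by omega
    have hB : K * m + 2 * m ≤ (K + 2) * n := by nlinarith [Nat.mul_le_mul_left K hmn]
    obtain ⟨x, hx, hxρ⟩ := hyp m hm1
    -- the even axis point `2m σ e_j` inside `Λ_{Km + 2m}`
    have hAm := sq_le_real_bconn_axis (d := 3) p hx hρ₀.le hxρ j s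
    rcases hm with hm | hm
    · -- even
      have hk2 : (s : ℤ) * (k : ℤ) = (s : ℤ) * (2 * (m : ℤ)) := by rw [hm]; push_cast; ring
      rw [hk2]
      calc (p : ℝ) * ρ₀ ^ 2 ≤ 1 * ρ₀ ^ 2 := mul_le_mul_of_nonneg_right hp1 (sq_nonneg _)
        _ = ρ₀ ^ 2 := one_mul _
        _ ≤ _ := hAm
        _ ≤ _ := real_bconn_box_mono p hB _ _
    · -- odd: one more edge inside `Λ_{Km + 2m}` (`2m + 1 ≤ Km + 2m` as `K, m ≥ 1`)
      have hKm : 1 ≤ K * m := Nat.one_le_iff_ne_zero.mpr (Nat.mul_ne_zero (by omega) (by omega))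
      have hv : (Pi.single j ((s : ℤ) * (2 * m)) : Site 3) ∈ box 3 (K * m + 2 * m) := by
        rw [mem_box]; intro l
        have hB' : 2 * (m : ℤ) ≤ ((K * m + 2 * m : ℕ) : ℤ) := by
          have : 2 * m ≤ K * m + 2 * m := by omega
          exact_mod_cast this
        by_cases hlj : l = j
        · subst hlj; rw [Pi.single_eq_same]
          rcases Int.units_eq_one_or s with hs | hs <;> simp [hs] <;> omega
        · rw [Pi.single_eq_of_ne hlj]; omega
      have hw : (Pi.single j ((s : ℤ) * k) : Site 3) ∈ box 3 (K * m + 2 * m) := by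
        rw [mem_box]; intro l
        have hB' : (k : ℤ) ≤ ((K * m + 2 * m : ℕ) : ℤ) := by
          have : k ≤ K * m + 2 * m := by omega
          exact_mod_cast this
        by_cases hlj : l = j
        · subst hlj; rw [Pi.single_eq_same]
          rcases Int.units_eq_one_or s with hs | hs <;> simp [hs] <;> omega
        · rw [Pi.single_eq_of_ne hlj]; omega
      have hadj : (zdGraph 3).Adj (Pi.single j ((s : ℤ) * (2 * m))) (Pi.single j ((s : ℤ) * k)) := by
        rw [zdGraph_adj_iff]
        refine ⟨j, ?_⟩
        rcases Int.units_eq_one_or s with hs | hs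
        · left
          have e : (1 : ℤ) * ((2 * m + 1 : ℕ) : ℤ) = 1 * (2 * (m : ℤ)) + 1 := by push_cast; ring
          rw [hs, Units.val_one, hm, e, Pi.single_add]
        · right
          have e : (-1 : ℤ) * (2 * (m : ℤ)) = -1 * ((2 * m + 1 : ℕ) : ℤ) + 1 := by push_cast; ring
          rw [hs, Units.val_neg, Units.val_one, hm, e, Pi.single_add]
      have h := real_bconn_adj_le p hadj hv hw (x := 0)
      calc (p : ℝ) * ρ₀ ^ 2 ≤ (p : ℝ) * μ.real (bconn (box 3 (K * m + 2 * m)) 0 (Pi.single j ((s : ℤ) * (2 * m)))) :=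
            mul_le_mul_of_nonneg_left hAm hp0
        _ ≤ _ := h
        _ ≤ _ := real_bconn_box_mono p hB _ _

/-- **Three legs** (Cerf 2015, §10, last display: "Using the FKG inequality, we conclude that
`∀ n ≥ 1 ∀ x ∈ Λ(2n) P(0 ↔ x in Λ(6n+n^α)) ≥ ρ^d`", at linear scale): if every axis point
`σ k e_j`, `k ≤ 2n`, is glued to `0` inside `Λ_B` with floor `ρ₁ ≥ 0`, then every `w ∈ Λ_{2n}` is
glued to `0` inside `Λ_{2n+B}` with floor `ρ₁³` (translation invariance and Harris–FKG along the
three coordinates). [cite: Cerf2015, §10] -/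
-- adapted from `Cerf2015BoxLRO16.exists_rho_large`
theorem legs_linear (p : unitInterval) {ρ₁ : ℝ} (hρ₁ : 0 ≤ ρ₁) {n B : ℕ}
    (haxis : ∀ (j : Fin 3) (s : ℤˣ) (k : ℕ), k ≤ 2 * n →
      ρ₁ ≤ (bondPercolation (zdGraph 3) p).real (bconn (box 3 B) 0 (Pi.single j ((s : ℤ) * k))))
    {w : Site 3} (hw : w ∈ box 3 (2 * n)) :
    ρ₁ ^ 3 ≤ (bondPercolation (zdGraph 3) p).real (bconn (box 3 (2 * n + B)) 0 w) := by
  set μ := bondPercolation (zdGraph 3) p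
  set T := box 3 (2 * n + B)
  have hwi : ∀ i, -(2 * (n : ℤ)) ≤ w i ∧ w i ≤ 2 * n := fun i => by
    have h := (mem_box.1 hw) i; push_cast at h; exact h
  -- the legs
  have hleg : ∀ u : Site 3, ∀ i : Fin 3, ρ₁ ≤ μ.real (bconn ((box 3 B).image (· + u)) u (u + Pi.single i (w i))) := by
    intro u i
    obtain ⟨s, k, hk, hkabs⟩ := exists_units_mul_natCast (w i)
    have hk2n : k ≤ 2 * n := by
      have h1 := hwi i
      have : (k : ℤ) ≤ 2 * n := by rw [hkabs, abs_le]; exact ⟨by linarith [h1.1], h1.2⟩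
      omega
    have h := haxis i s k hk2n
    rw [← hk] at h
    have ht := real_bconn_translate p (box 3 B) u 0 (Pi.single i (w i))
    rw [zero_add, add_comm] at ht
    rw [ht]; exact h
  have hsub : ∀ u ∈ box 3 (2 * n), (box 3 B).image (· + u) ⊆ T := fun u hu =>
    ball_subset_box_add (r := B) hu
  -- the intermediate points
  set z₁ : Site 3 := Pi.single 0 (w 0) with hz₁
  set z₂ : Site 3 := z₁ + Pi.single 1 (w 1) with hz₂
  have hz₁w : z₁ = 0 + Pi.single 0 (w 0) := (zero_add _).symm
  have hwz : w = z₂ + Pi.single 2 (w 2) := by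
    funext l; fin_cases l <;> simp [hz₂, hz₁]
  have hz₁mem : z₁ ∈ box 3 (2 * n) := by
    rw [mem_box]; intro l; fin_cases l <;> simp [hz₁, hwi 0]
  have hz₂mem : z₂ ∈ box 3 (2 * n) := by
    rw [mem_box]; intro l; fin_cases l <;> simp [hz₂, hz₁, hwi 0, hwi 1]
  have hleg0 := hleg 0 0
  rw [← hz₁w] at hleg0
  have hleg1 := hleg z₁ 1
  have hleg2 := hleg z₂ 2
  rw [← hwz] at hleg2
  have h01 := real_bconn_mul_le p (hsub 0 (zero_mem_box 3 _)) (hsub z₁ hz₁mem) 0 z₁ z₂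
  have h012 := real_bconn_mul_le p (subset_refl T) (hsub z₂ hz₂mem) 0 z₂ w
  calc ρ₁ ^ 3 = ρ₁ * ρ₁ * ρ₁ := by ring
    _ ≤ μ.real (bconn ((box 3 B).image (· + (0 : Site 3))) 0 z₁) * μ.real (bconn ((box 3 B).image (· + z₁)) z₁ z₂) *
          μ.real (bconn ((box 3 B).image (· + z₂)) z₂ w) :=
        mul_le_mul (mul_le_mul hleg0 hleg1 hρ₁ measureReal_nonneg) hleg2 hρ₁
          (mul_nonneg measureReal_nonneg measureReal_nonneg)
    _ ≤ μ.real (bconn T 0 z₂) * μ.real (bconn ((box 3 B).image (· + z₂)) z₂ w) :=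
        mul_le_mul_of_nonneg_right h01 measureReal_nonneg
    _ ≤ μ.real (bconn T 0 w) := h012

end LinearScaleLROChaining

open Literature.Probability.Percolation Literature.Probability.Percolation.AKN
  Literature.Probability.LatticeModels MeasureTheory in
/-- **Stub `stub_fkgChaining`** of line `birth` (crux stmt-CriticalPhenomena-0855) — Cerf 2015, §10,
closing paragraph, at LINEAR scale for bond percolation on `ℤ³`: if for some `ρ₀ > 0`, `K ≥ 1` and
every `n ≥ 1` some inner-boundary site `x ∈ ∂ⁱⁿΛ_n` has `P_p(0 ↔ x in Λ_{Kn}) ≥ ρ₀`, then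
`P_p(x ↔ y in Λ_{K'n}) ≥ ρ` for all `n ≥ 1` and all `x, y ∈ Λ_n`, with `ρ = (p ρ₀²)³ > 0` (`p > 0`
is forced by the hypothesis at `n = 1`) and `K' = K + 5`: axis points by symmetry, reflection,
Harris–FKG and one extra edge (`LinearScaleLROChaining.axis_all_linear`), three translated legs
(`LinearScaleLROChaining.legs_linear`), a last translation by `x`, and the identification of
`openConnIn` with `AKN.bconn`. [cite: Cerf2015, §10] -/
theorem stub_fkgChaining :
    ∀ p : unitInterval, ∀ ρ₀ : ℝ, 0 < ρ₀ → ∀ K : ℕ, 1 ≤ K →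
      (∀ n : ℕ, 1 ≤ n → ∃ x ∈ innerBoundary (zdGraph 3) (box 3 n),
        ρ₀ ≤ (bondPercolation (zdGraph 3) p).real
          (openConnIn (↑(box 3 (K * n)) : Set (Site 3)) (0 : Site 3) x)) →
      ∃ ρ : ℝ, 0 < ρ ∧ ∃ K' : ℕ, ∀ n : ℕ, 1 ≤ n → ∀ x ∈ box 3 n, ∀ y ∈ box 3 n,
        ρ ≤ (bondPercolation (zdGraph 3) p).real
          (openConnIn (↑(box 3 (K' * n)) : Set (Site 3)) x y) := by
  intro p ρ₀ hρ₀ K hK hyp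
  -- the hypothesis in terms of the lattice-path event `bconn`
  have hyp' : ∀ m : ℕ, 1 ≤ m → ∃ x ∈ innerBoundary (zdGraph 3) (box 3 m),
      ρ₀ ≤ (bondPercolation (zdGraph 3) p).real (AKN.bconn (box 3 (K * m)) 0 x) := by
    intro m hm
    obtain ⟨x, hx, h⟩ := hyp m hm
    refine ⟨x, hx, ?_⟩
    rwa [LinearScaleLROChaining.real_openConnIn_box_eq p (zero_mem_box 3 (K * m)) x] at h
  -- `p > 0` and `ρ₀ ≤ 1`
  obtain ⟨x₁, hx₁, hx₁ρ⟩ := hyp 1 le_rfl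
  have hp0 : 0 < (p : ℝ) := LinearScaleLROChaining.coe_pos_of_glued p hρ₀ hx₁ hx₁ρ
  have hρ₀1 : ρ₀ ≤ 1 := hx₁ρ.trans measureReal_le_one
  have hρ₁ : 0 < (p : ℝ) * ρ₀ ^ 2 := by positivity
  refine ⟨((p : ℝ) * ρ₀ ^ 2) ^ 3, by positivity, K + 5, ?_⟩
  intro n hn x hx y hy
  have hnK : n ≤ (K + 5) * n := Nat.le_mul_of_pos_left n (by omega)
  rw [LinearScaleLROChaining.real_openConnIn_box_eq p (box_mono 3 hnK hx) y]
  -- every `w ∈ Λ_{2n}` from `0` inside `Λ_{2n + (K+2)n}`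
  have hw : y - x ∈ box 3 (2 * n) := by
    rw [mem_box] at hx hy ⊢
    intro l; have h1 := hx l; have h2 := hy l
    rw [Pi.sub_apply]; push_cast; constructor <;> linarith [h1.1, h1.2, h2.1, h2.2]
  have hlegs := LinearScaleLROChaining.legs_linear p hρ₁.le (n := n) (B := (K + 2) * n)
    (fun j s k hk => LinearScaleLROChaining.axis_all_linear p hρ₀ hρ₀1 hK hyp' hn j s hk) hw
  -- translate by `x`
  have ht := AKN.real_bconn_translate p (box 3 (2 * n + (K + 2) * n)) x 0 (y - x)
  rw [zero_add, sub_add_cancel] at ht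
  have hsub : (box 3 (2 * n + (K + 2) * n)).image (· + x) ⊆ box 3 ((K + 5) * n) := by
    have h' := Cerf2015BoxLRO16.ball_subset_box_add (r := 2 * n + (K + 2) * n) hx
    have heq : n + (2 * n + (K + 2) * n) = (K + 5) * n := by ring
    rw [heq] at h'
    exact h'
  calc ((p : ℝ) * ρ₀ ^ 2) ^ 3 ≤ _ := hlegs
    _ = _ := ht.symm
    _ ≤ _ := measureReal_mono (openConnVia_mono_graph (withinGraph_mono _ (Finset.coe_subset.2 hsub)) x y)
        (measure_ne_top _ _)

end Summit.CriticalPhenomena.PercolationContinuityZ3.Theorems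

end
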